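import Summits.ValiantsHypothesis.ValiantsHypothesis.Theses.BorderApolarity
import Summits.ValiantsHypothesis.ValiantsHypothesis.Theorems.ToricFixedPoints.Negative.WithoutUpperLimitFalse
import Summits.ValiantsHypothesis.ValiantsHypothesis.Theorems.BorderApolarityFixedWitnessObstructionQPAnnSubmodule
import Summits.ValiantsHypothesis.ValiantsHypothesis.Theorems.BorderApolarityToricFixedPointsToricLimitIsInitialAux1
import Summits.ValiantsHypothesis.ValiantsHypothesis.Theorems.BorderApolarityToricFixedPointsToricLimitIsInitial
import Summits.ValiantsHypothesis.ValiantsHypothesis.Theorems.BorderApolarityToricFixedPointsCellApproachableAux1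
import Literature.Computability.AlgebraicComplexity.ApolarityAction
import Literature.Computability.AlgebraicComplexity.ApolarityTopPairing
import Literature.Computability.AlgebraicComplexity.DeterminantIrreducible

/-!
# `ToricFixedPoints` — the INTERIOR strengthening is false (via S1 `stub_toricLimitIsInitial`, landed)

Crux `Summit.ValiantsHypothesis.ValiantsHypothesis.Theses.BorderApolarity.ToricFixedPoints`
(stmt-ValiantsHypothesis-5779).  `ToricFixedPointsInterior` is the crux with its conclusion
STRENGTHENED to "`J` is an interior point": `∃ g ∈ GL_{m²}`, `J = K-lim Ann(Q_t)` for the CONSTANT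
sequence `Q_t = g · det_m` (the crux's conclusion with `w = 0`, `u = 1`).  It is false: boundary
`H₀`-fixed points exist.  Witness (`n = m = 3`): the toric curve `P_t = diag((t+2)^w) · det_3` with
`w` = indicator of the diagonal variables `x₀₀, x₁₁, x₂₂` (so `[P_t] → [x₀₀x₁₁x₂₂]`); its Kuratowski
limit `Jdiag` is supplied by S1 (`stub_toricLimitIsInitial`, landed in
`Theorems/BorderApolarityToricFixedPointsToricLimitIsInitial.lean`); `Jdiag` is `H₀(3,3) = T`-stable because every
`P_t` is a `T`-weight vector (`linSubst_diagonal_detPoly`: `diag(a_i b_j) · det = (∏a∏b) det`) and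
Kuratowski limits of `T`-stable spaces are `T`-stable (`kLimit_linSubst_stable_of_semiInvariant`,
`Jdiag_h0Stable`); and `Jdiag 3 ∋ ∂^e` for every degree-3 exponent
`e ≠ (1,1,1 on the diagonal)` (`monomial_mem_inSpan_three`: `∂^e - c_e ∂^{e_id} ∈ Ann_3(det_3)` has
lowest `w`-part `∂^e`).  If `Jdiag` were `Ann(g·det_3)` then `g·det_3 ∝ x₀₀x₁₁x₂₂`, whose degree-1
annihilator contains `∂₀₁ ≠ 0`, contradicting `dim Ann_1(g·det_3) = 9 - 9 = 0` (`stub_annSubmodule`; `Jdiag_not_interior`).  The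
named objects `Pdiag`, `Jdiag` with (ORB) `Pdiag_mem_glOrbit`, (LIM) `isBorderApolarLimit_diag`, (W4)
`Jdiag_h0Stable`, (GEN) `monomial_mem_Jdiag_three`, (BDRY) `Jdiag_not_interior` form the first
Lean-available BOUNDARY `H₀`-fixed point of `Z_det`, reusable by other seats (stub tests).
Refuter cdisprove unit, cycle 3 (`Cruxes/ToricFixedPoints/Disproof.lean` §7). [folklore]
-/

namespace Summit.ValiantsHypothesis.Cruxes.ToricFixedPoints.Negative

open Literature.Computability.AlgebraicComplexity
open Literature.Computability.AlgebraicComplexity.BorderApolarity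
open Summit.ValiantsHypothesis.ValiantsHypothesis.Theorems.BorderApolarityToricFixedPoints
open Summit.ValiantsHypothesis.ValiantsHypothesis.Theorems.BorderApolarityFixedWitnessObstructionQP
open scoped BigOperators Matrix
open Filter MvPolynomial

/-- The crux `ToricFixedPoints` with its conclusion strengthened to "the fixed point is an INTERIOR
point of `Z_det`": `∃ g`, `J` is the border-apolar limit of the constant sequence `Q_t = g·det_m`
(= the crux's conclusion with `w = 0`, `u = 1`; hypotheses verbatim). -/
def ToricFixedPointsInterior : Prop :=
  ∀ (n m : ℕ) [NeZero m], 3 ≤ n → n ≤ m → let act := fun (D f : MvPolynomial (Fin m × Fin m) ℂ) => ∑ e ∈ D.support, ∑ d ∈ f.support, MvPolynomial.monomial (d - e) (MvPolynomial.coeff e D * MvPolynomial.coeff d f * ∏ i ∈ e.support, (Nat.descFactorial (d i) (e i) : ℂ)); let rk := fun (p : Fin m × Fin m) => (if (m - n ≤ (p.1 : ℕ) ∧ m - n ≤ (p.2 : ℕ)) ∨ p = (0, 0) then 0 else m * m) + ((p.1 : ℕ) * m + (p.2 : ℕ)); ∀ (P : ℕ → MvPolynomial (Fin m × Fin m) ℂ)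 (J : ℕ → Set (MvPolynomial (Fin m × Fin m) ℂ)), (∀ t : ℕ, P t ∈ Literature.Computability.AlgebraicComplexity.glOrbit (Fin m × Fin m) ℂ (Literature.Computability.AlgebraicComplexity.detPoly (Fin m) ℂ)) → (∀ k ≤ m, ∀ D ∈ J k, ∃ Ds : ℕ → MvPolynomial (Fin m × Fin m) ℂ, (∀ t, (Ds t).IsHomogeneous k ∧ act (Ds t) (P t) = 0) ∧ Filter.Tendsto (fun t => Literature.Computability.AlgebraicComplexity.coeffVec (Ds t)) Filter.atTop (nhds (Literature.Computability.AlgebraicComplexity.coeffVec D))) ∧ (∀ k ≤ m, ∀ (D : MvPolynomial (Fin m × Fin m) ℂ) (φ : ℕ → ℕ) (Ds : ℕ → MvPolynomial (Fin m × Fin m) ℂ), StrictMono φ → (∀ t, (Ds t).IsHomogeneous k ∧ act (Ds t) (P (φ t)) = 0) → Filter.Tendsto (fun t => Literature.Computability.AlgebraicComplexity.coeffVec (Ds t)) Filter.atTop (nhds (Literature.Computability.AlgebraicComplexity.coeffVec D)) → D ∈ J k) → (∀ A : Matrix.GeneralLinearGroup (Fin m × Fin m) ℂ, let M : Matrix (Fin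 m × Fin m) (Fin m × Fin m) ℂ := A; (∀ i j : Fin m × Fin m, M j i ≠ 0 → rk j ≤ rk i) → (∀ i j : Fin m × Fin m, ((m - n ≤ (i.1 : ℕ) ∧ m - n ≤ (i.2 : ℕ)) ∨ i = (0, 0)) → j ≠ i → M j i = 0) → (∀ i k j l : Fin m, m - n ≤ (i : ℕ) → m - n ≤ (k : ℕ) → m - n ≤ (j : ℕ) → m - n ≤ (l : ℕ) → M (i, j) (i, j) * M (k, l) (k, l) = M (i, l) (i, l) * M (k, j) (k, j)) → M (0, 0) (0, 0) ^ (m - n) * ∏ i ∈ Finset.univ.filter (fun i : Fin m => m - n ≤ (i : ℕ)), M (i, i) (i, i) = 1 → ∀ k ≤ m, ∀ D ∈ J k, Literature.Computability.AlgebraicComplexity.linSubst (Fin m × Fin m) ℂ Mᵀ D ∈ J k) → ∃ g : Matrix.GeneralLinearGroup (Fin m × Fin m) ℂ, let Q : ℕ → MvPolynomial (Fin m × Fin m) ℂ := fun _ => Literature.Computability.AlgebraicComplexity.linSubst (Fin m × Fin m) ℂ (g : Matrix (Fin m × Fin m) (Fin m × Fin m) ℂ) (Literature.Computability.AlgebraicComplexity.detPoly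 (Fin m) ℂ); (∀ k ≤ m, ∀ D ∈ J k, ∃ Ds : ℕ → MvPolynomial (Fin m × Fin m) ℂ, (∀ t, (Ds t).IsHomogeneous k ∧ act (Ds t) (Q t) = 0) ∧ Filter.Tendsto (fun t => Literature.Computability.AlgebraicComplexity.coeffVec (Ds t)) Filter.atTop (nhds (Literature.Computability.AlgebraicComplexity.coeffVec D))) ∧ (∀ k ≤ m, ∀ (D : MvPolynomial (Fin m × Fin m) ℂ) (φ : ℕ → ℕ) (Ds : ℕ → MvPolynomial (Fin m × Fin m) ℂ), StrictMono φ → (∀ t, (Ds t).IsHomogeneous k ∧ act (Ds t) (Q (φ t)) = 0) → Filter.Tendsto (fun t => Literature.Computability.AlgebraicComplexity.coeffVec (Ds t)) Filter.atTop (nhds (Literature.Computability.AlgebraicComplexity.coeffVec D)) → D ∈ J k)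

section General

variable {σ : Type*}

/-- Weighted components of a monomial. [folklore] -/
theorem weightedHomogeneousComponent_monomial' [DecidableEq σ] (w : σ → ℤ) (ν : ℤ) (d : σ →₀ ℕ) (a : ℂ) :
    weightedHomogeneousComponent w ν (monomial d a) =
      if Finsupp.weight w d = ν then monomial d a else 0 := by
  classical
  ext e
  rw [coeff_weightedHomogeneousComponent]
  by_cases hed : e = d
  · subst hed
    split_ifs <;> simp
  · have : coeff e (monomial d a) = 0 := by rw [coeff_monomial, if_neg (Ne.symm hed)]
    rw [this]
    split_ifs <;> first | rfl | (rw [coeff_zero]) | (rw [coeff_monomial, if_neg (Ne.symm hed)])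

/-- A diagonal substitution with a rank-one pattern `d_{ij}` (`d_{ij} d_{kl} = d_{il} d_{kj}`,
`d₀₀ ≠ 0`) rescales the generic determinant: `diag(d) · det = (∏ᵢ d_{i0}/d₀₀ · ∏ⱼ d_{0j}) det`.
(Row/column scaling `X ↦ diag(a) X diag(b)`.) [folklore] -/
theorem linSubst_diagonal_detPoly {m : ℕ} [NeZero m] (d : Fin m × Fin m → ℂ)
    (hrel : ∀ i k j l : Fin m, d (i, j) * d (k, l) = d (i, l) * d (k, j)) (h0 : d (0, 0) ≠ 0) :
    linSubst (Fin m × Fin m) ℂ (Matrix.diagonal d) (detPoly (Fin m) ℂ) =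
      ((∏ i : Fin m, d (i, 0) / d (0, 0)) * ∏ j : Fin m, d (0, j)) • detPoly (Fin m) ℂ := by
  set a : Fin m → ℂ := fun i => d (i, 0) / d (0, 0) with ha
  set b : Fin m → ℂ := fun j => d (0, j) with hb
  have hab : ∀ i j, a i * b j = d (i, j) := by
    intro i j
    simp only [ha, hb]
    have := hrel i 0 0 j
    field_simp
    linear_combination this
  unfold detPoly
  rw [AlgHom.map_det]
  have hmat : (linSubst (Fin m × Fin m) ℂ (Matrix.diagonal d)).mapMatrix (Matrix.mvPolynomialX (Fin m) (Fin m) ℂ)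
      = Matrix.diagonal (fun i => C (a i)) * Matrix.mvPolynomialX (Fin m) (Fin m) ℂ *
          Matrix.diagonal (fun j => C (b j)) := by
    ext i j
    rw [Matrix.mul_diagonal, Matrix.diagonal_mul, AlgHom.mapMatrix_apply, Matrix.map_apply,
      Matrix.mvPolynomialX_apply, tli_linSubst_diagonal_X, ← hab i j, smul_eq_C_mul, map_mul]
    ring
  rw [hmat, Matrix.det_mul, Matrix.det_mul, Matrix.det_diagonal, Matrix.det_diagonal, smul_eq_C_mul,
    map_mul, map_prod, map_prod]
  ring

end General

/-- **Kuratowski limits of semi-invariant curves are stable.**  If `J` is the border-apolar limit of a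
sequence `P_t` each of which is an EIGENVECTOR of the substitution `M` (`M · P_t = χ_t P_t`, `M`
invertible), then every `J k`, `k ≤ m`, is stable under `D ↦ linSubst Mᵀ D`: transport approximants
(`Ann(P_t)` is `Mᵀ`-stable by `GL`-equivariance of apolarity) and use (Ls) along `φ = id` with the
coefficientwise continuity of `linSubst`.  This is how `H₀`-stability (W4) of toric limits of
`H₀`-semi-invariant curves comes for free. [folklore] -/
theorem kLimit_linSubst_stable_of_semiInvariant {m : ℕ} {P : ℕ → MvPolynomial (Fin m × Fin m) ℂ}
    {J : ℕ → Set (MvPolynomial (Fin m × Fin m) ℂ)} (hJ : IsBorderApolarLimit m P J)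
    (M : Matrix (Fin m × Fin m) (Fin m × Fin m) ℂ) (hM : IsUnit M.det) (χ : ℕ → ℂ)
    (hsemi : ∀ t, linSubst (Fin m × Fin m) ℂ M (P t) = χ t • P t) :
    ∀ k ≤ m, ∀ D ∈ J k, linSubst (Fin m × Fin m) ℂ Mᵀ D ∈ J k := by
  classical
  intro k hk D hD
  obtain ⟨Ds, hDs, hDlim⟩ := hJ.1 k hk D hD
  have hDhom : D.IsHomogeneous k := hJ.isHomogeneous_of_mem hk hD
  refine hJ.2 k hk _ id (fun t => linSubst (Fin m × Fin m) ℂ Mᵀ (Ds t)) strictMono_id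
    (fun t => ⟨linSubst_isHomogeneous _ (hDs t).1, ?_⟩)
    (tli_tendsto_coeffVec_linSubst _ (fun t => (hDs t).1) hDhom hDlim)
  show apolarAction (linSubst (Fin m × Fin m) ℂ Mᵀ (Ds t)) (P t) = 0
  rw [← apolarAction_linSubst_eq_zero_iff _ hM, hsemi t, apolarAction_smul_right, (hDs t).2, smul_zero]

/-- The weight: indicator of the diagonal variables `x₀₀, x₁₁, x₂₂`. -/
def wDiag : Fin 3 × Fin 3 → ℤ := fun p => if p.1 = p.2 then 1 else 0

/-- The exponent of the diagonal monomial `x₀₀ x₁₁ x₂₂` (`= permMonomial 1`). -/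
noncomputable def eId : (Fin 3 × Fin 3) →₀ ℕ := permMonomial (1 : Equiv.Perm (Fin 3))

/-- The `wDiag`-weight of a permutation pattern is its number of fixed points. [folklore] -/
theorem weight_wDiag_permMonomial (ρ : Equiv.Perm (Fin 3)) :
    Finsupp.weight wDiag (permMonomial ρ) = ∑ i : Fin 3, (if ρ i = i then (1 : ℤ) else 0) := by
  rw [permMonomial, map_sum]
  refine Finset.sum_congr rfl fun i _ => ?_
  rw [Finsupp.weight_single, one_smul, wDiag]

/-- The diagonal monomial has `wDiag`-weight `3`. [folklore] -/
theorem weight_wDiag_eId : Finsupp.weight wDiag eId = 3 := by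
  rw [eId, weight_wDiag_permMonomial]
  simp

/-- Only the identity has all three diagonal variables. [folklore] -/
theorem eq_one_of_weight_eq_three (ρ : Equiv.Perm (Fin 3))
    (h : Finsupp.weight wDiag (permMonomial ρ) = 3) : ρ = 1 := by
  rw [weight_wDiag_permMonomial, Finset.sum_boole] at h
  have hcard : (Finset.univ.filter fun i : Fin 3 => ρ i = i).card = (Finset.univ : Finset (Fin 3)).card := by
    rw [Finset.card_univ, Fintype.card_fin]
    exact_mod_cast h
  rw [Finset.card_filter_eq_iff] at hcard
  ext i
  exact congrArg Fin.val (hcard i (Finset.mem_univ i))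

/-- `wDiag`-weights are bounded by the degree. [folklore] -/
theorem weight_wDiag_le_degree (e : (Fin 3 × Fin 3) →₀ ℕ) :
    Finsupp.weight wDiag e ≤ (e.degree : ℤ) := by
  rw [Finsupp.weight_apply, Finsupp.sum, Finsupp.degree_apply, Nat.cast_sum]
  refine Finset.sum_le_sum fun i _ => ?_
  simp only [wDiag]
  split_ifs <;> simp

/-- **Generators of `J_3`.**  For every degree-3 exponent `e ≠ e_id`, the monomial operator `∂^e`
lies in the span of the lowest-`wDiag`-weight initial forms of `Ann_3(det_3)`: the operator
`E = ∂^e - (det_e · e!) ∂^{e_id}` annihilates `det_3` (top-degree pairing), and its lowest weight part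
is `∂^e` (if `det_e ≠ 0` then `e` is a non-identity permutation pattern, of weight `< 3 = wt(e_id)`).
[folklore] -/
theorem monomial_mem_inSpan_three (e : (Fin 3 × Fin 3) →₀ ℕ) (he : e.degree = 3) (hne : e ≠ eId) :
    (monomial e (1 : ℂ)) ∈ Submodule.span ℂ {D' : MvPolynomial (Fin 3 × Fin 3) ℂ |
      ∃ E ∈ annihilatorOfDegree (detPoly (Fin 3) ℂ) 3, ∃ ν : ℤ,
        D' = weightedHomogeneousComponent wDiag ν E ∧
          ∀ ν' : ℤ, ν' < ν → weightedHomogeneousComponent wDiag ν' E = 0} := by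
  classical
  set c : ℂ := coeff e (detPoly (Fin 3) ℂ) with hc
  set κ : ℂ := ∏ i ∈ e.support, ((e i).factorial : ℂ) with hκ
  set E : MvPolynomial (Fin 3 × Fin 3) ℂ := monomial e 1 - monomial eId (c * κ) with hE
  have hdet3 : (detPoly (Fin 3) ℂ).IsHomogeneous 3 := by
    simpa using detPoly_isHomogeneous (n := Fin 3) (k := ℂ)
  have heIddeg : eId.degree = 3 := by
    have h1 : ((1 : Equiv.Perm (Fin 3)) : Fin 3 → Fin 3) = id := rfl
    rw [eId, Finsupp.degree_eq_weight_one]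
    exact hdet3 (by rw [coeff_permMonomial_detPoly]; simp)
  -- pairing of a monomial operator with `det_3`
  have hpair : ∀ (d : (Fin 3 × Fin 3) →₀ ℕ) (a : ℂ), d.degree = 3 →
      apolarAction (monomial d a) (detPoly (Fin 3) ℂ) =
        C (a * coeff d (detPoly (Fin 3) ℂ) * ∏ i ∈ d.support, ((d i).factorial : ℂ)) := by
    intro d a hd
    by_cases ha : a = 0
    · rw [ha, monomial_zero, ← C_0, apolarAction_C, zero_smul, zero_mul, zero_mul, C_0]
    rw [apolarAction_eq_C (isHomogeneous_monomial a hd) hdet3, support_monomial, if_neg ha,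
      Finset.sum_singleton, coeff_monomial, if_pos rfl]
  have hEann : E ∈ annihilatorOfDegree (detPoly (Fin 3) ℂ) 3 := by
    rw [mem_annihilatorOfDegree_iff]
    refine ⟨(isHomogeneous_monomial _ he).sub (isHomogeneous_monomial _ heIddeg), ?_⟩
    rw [hE, apolarAction_sub_left, hpair e 1 he, hpair eId (c * κ) heIddeg, sub_eq_zero]
    congr 1
    have h1 : coeff eId (detPoly (Fin 3) ℂ) = 1 := by
      rw [eId, coeff_permMonomial_detPoly]; simp
    have h2 : (∏ i ∈ eId.support, ((eId i).factorial : ℂ)) = 1 := by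
      refine Finset.prod_eq_one fun i _ => ?_
      rcases i with ⟨r, s⟩
      rw [eId, permMonomial_apply]
      split_ifs <;> simp
    rw [h1, h2, hc, hκ]; ring
  -- the lowest weight part of `E` is `∂^e`
  set ν : ℤ := Finsupp.weight wDiag e with hν
  have hsecond : ∀ ν' : ℤ, ν' ≤ ν → weightedHomogeneousComponent wDiag ν' (monomial eId (c * κ)) = 0 := by
    intro ν' hν'
    by_cases hc0 : c = 0
    · rw [hc0, zero_mul, monomial_zero, map_zero]
    rw [weightedHomogeneousComponent_monomial', weight_wDiag_eId, if_neg]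
    intro h3
    -- `c ≠ 0`: `e` is a permutation pattern, not the identity, so `ν < 3`
    obtain ⟨ρ, hρ⟩ := exists_permMonomial_eq_of_coeff_detPoly_ne_zero ℂ (d := e) hc0
    have hρ1 : ρ ≠ 1 := by
      rintro rfl; exact hne (by rw [← hρ]; rfl)
    have hlt : ν < 3 := by
      have hle : ν ≤ 3 := by
        have := weight_wDiag_le_degree e
        rw [he] at this; exact_mod_cast this
      refine lt_of_le_of_ne hle fun h => hρ1 (eq_one_of_weight_eq_three ρ ?_)
      rw [hρ]; exact h
    omega
  refine Submodule.subset_span ⟨E, hEann, ν, ?_, ?_⟩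
  · rw [hE, map_sub, hsecond ν le_rfl, sub_zero, weightedHomogeneousComponent_monomial', if_pos rfl]
  · intro ν' hν'
    rw [hE, map_sub, hsecond ν' hν'.le, sub_zero, weightedHomogeneousComponent_monomial', if_neg]
    exact fun h => (hν ▸ h ▸ hν').false

/-- The toric curve `P_t = 1 · diag((t+2)^{wDiag}) · det_3` (written with `u = 1 ∈ GL` so that it is
syntactically S1's curve). -/
noncomputable def Pdiag : ℕ → MvPolynomial (Fin 3 × Fin 3) ℂ := fun t =>
  linSubst (Fin 3 × Fin 3) ℂ ((1 : Matrix.GeneralLinearGroup (Fin 3 × Fin 3) ℂ) :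
      Matrix (Fin 3 × Fin 3) (Fin 3 × Fin 3) ℂ)
    (linSubst (Fin 3 × Fin 3) ℂ (Matrix.diagonal fun i : Fin 3 × Fin 3 => ((t : ℂ) + 2) ^ (wDiag i))
      (detPoly (Fin 3) ℂ))

/-- The span of the lowest-`wDiag`-weight initial forms of `Ann_k(det_3)`. -/
noncomputable def SpDiag (k : ℕ) : Submodule ℂ (MvPolynomial (Fin 3 × Fin 3) ℂ) :=
  Submodule.span ℂ {D' : MvPolynomial (Fin 3 × Fin 3) ℂ |
    ∃ E ∈ annihilatorOfDegree (detPoly (Fin 3) ℂ) k, ∃ ν : ℤ,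
      D' = weightedHomogeneousComponent wDiag ν E ∧
        ∀ ν' : ℤ, ν' < ν → weightedHomogeneousComponent wDiag ν' E = 0}

/-- **The boundary fixed point** `Jdiag = K-lim_t Ann(Pdiag t)` (S1's description, `u = 1`). -/
def Jdiag : ℕ → Set (MvPolynomial (Fin 3 × Fin 3) ℂ) := fun k =>
  {D | linSubst (Fin 3 × Fin 3) ℂ ((1 : Matrix.GeneralLinearGroup (Fin 3 × Fin 3) ℂ) :
      Matrix (Fin 3 × Fin 3) (Fin 3 × Fin 3) ℂ)ᵀ D ∈ SpDiag k}

/-- The unit of `GL` coerces to the identity matrix. [folklore] -/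
theorem coe_one_GL3 : ((1 : Matrix.GeneralLinearGroup (Fin 3 × Fin 3) ℂ) :
    Matrix (Fin 3 × Fin 3) (Fin 3 × Fin 3) ℂ) = 1 := Units.val_one

/-- `Pdiag t` with the `u = 1` substitution simplified away. [folklore] -/
theorem Pdiag_eq (t : ℕ) : Pdiag t = linSubst (Fin 3 × Fin 3) ℂ
    (Matrix.diagonal fun i : Fin 3 × Fin 3 => ((t : ℂ) + 2) ^ (wDiag i)) (detPoly (Fin 3) ℂ) := by
  simp only [Pdiag, coe_one_GL3, linSubst_one, AlgHom.id_apply]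

/-- Membership in `Jdiag k` is membership in the initial span `SpDiag k` (`u = 1`). [folklore] -/
theorem mem_Jdiag_iff {k : ℕ} {D : MvPolynomial (Fin 3 × Fin 3) ℂ} : D ∈ Jdiag k ↔ D ∈ SpDiag k := by
  simp only [Jdiag, Set.mem_setOf_eq, coe_one_GL3, Matrix.transpose_one, linSubst_one, AlgHom.id_apply]

/-- (LIM) `Jdiag` is the border-apolar (Kuratowski) limit of `Ann(Pdiag t)`: S1
`stub_toricLimitIsInitial` (landed, `Theorems/BorderApolarityToricFixedPointsToricLimitIsInitial.lean`)
at `m = 3`, `u = 1`, `w = wDiag`, `f = det_3`. -/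
theorem isBorderApolarLimit_diag : IsBorderApolarLimit 3 Pdiag Jdiag :=
  stub_toricLimitIsInitial 3 1 wDiag (detPoly (Fin 3) ℂ)

/-- (ORB) every `Pdiag t` lies in the orbit `GL_9 · det_3`. -/
theorem Pdiag_mem_glOrbit (t : ℕ) : Pdiag t ∈ glOrbit (Fin 3 × Fin 3) ℂ (detPoly (Fin 3) ℂ) := by
  have := toricCurve_mem_glOrbit (1 : Matrix.GeneralLinearGroup (Fin 3 × Fin 3) ℂ) 1 wDiag t
  rw [Pdiag_eq t]
  simpa only [coe_one_GL3, linSubst_one, AlgHom.id_apply] using this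

/-- `det_3` is a cubic form. [folklore] -/
theorem detPoly_three_isHomogeneous : (detPoly (Fin 3) ℂ).IsHomogeneous 3 := by
  simpa using detPoly_isHomogeneous (n := Fin 3) (k := ℂ)

/-- (W4) **`Jdiag` is `H₀(3,3)`-stable**: the crux's stability clause at `n = m = 3`, verbatim (after
`dsimp` of its `let`s).  At `n = m` conditions (a)–(d) make `M` diagonal with a rank-one pattern, so
`M · Pdiag t = χ · Pdiag t` (`linSubst_diagonal_detPoly`), and `kLimit_linSubst_stable_of_semiInvariant`
concludes. [folklore] -/
theorem Jdiag_h0Stable : ∀ A : Matrix.GeneralLinearGroup (Fin 3 × Fin 3) ℂ,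
    (∀ i j : Fin 3 × Fin 3, (A : Matrix (Fin 3 × Fin 3) (Fin 3 × Fin 3) ℂ) j i ≠ 0 →
      (if (3 - 3 ≤ (j.1 : ℕ) ∧ 3 - 3 ≤ (j.2 : ℕ)) ∨ j = (0, 0) then 0 else 3 * 3) + ((j.1 : ℕ) * 3 + (j.2 : ℕ)) ≤
      (if (3 - 3 ≤ (i.1 : ℕ) ∧ 3 - 3 ≤ (i.2 : ℕ)) ∨ i = (0, 0) then 0 else 3 * 3) + ((i.1 : ℕ) * 3 + (i.2 : ℕ))) →
    (∀ i j : Fin 3 × Fin 3, ((3 - 3 ≤ (i.1 : ℕ) ∧ 3 - 3 ≤ (i.2 : ℕ)) ∨ i = (0, 0)) → j ≠ i →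
      (A : Matrix (Fin 3 × Fin 3) (Fin 3 × Fin 3) ℂ) j i = 0) →
    (∀ i k j l : Fin 3, 3 - 3 ≤ (i : ℕ) → 3 - 3 ≤ (k : ℕ) → 3 - 3 ≤ (j : ℕ) → 3 - 3 ≤ (l : ℕ) →
      (A : Matrix (Fin 3 × Fin 3) (Fin 3 × Fin 3) ℂ) (i, j) (i, j) * (A : Matrix (Fin 3 × Fin 3) (Fin 3 × Fin 3) ℂ) (k, l) (k, l) =
      (A : Matrix (Fin 3 × Fin 3) (Fin 3 × Fin 3) ℂ) (i, l) (i, l) * (A : Matrix (Fin 3 × Fin 3) (Fin 3 × Fin 3) ℂ) (k, j) (k, j)) →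
    (A : Matrix (Fin 3 × Fin 3) (Fin 3 × Fin 3) ℂ) (0, 0) (0, 0) ^ (3 - 3) *
      ∏ i ∈ Finset.univ.filter (fun i : Fin 3 => 3 - 3 ≤ (i : ℕ)),
        (A : Matrix (Fin 3 × Fin 3) (Fin 3 × Fin 3) ℂ) (i, i) (i, i) = 1 →
    ∀ k ≤ 3, ∀ D ∈ Jdiag k, linSubst (Fin 3 × Fin 3) ℂ (A : Matrix (Fin 3 × Fin 3) (Fin 3 × Fin 3) ℂ)ᵀ D ∈ Jdiag k := by
  intro A _ha hb hc _hd
  set dA : Fin 3 × Fin 3 → ℂ := fun i => (A : Matrix (Fin 3 × Fin 3) (Fin 3 × Fin 3) ℂ) i i with hdA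
  have hMdiag : (A : Matrix (Fin 3 × Fin 3) (Fin 3 × Fin 3) ℂ) = Matrix.diagonal dA := by
    ext j i
    by_cases hji : j = i
    · subst hji
      rw [Matrix.diagonal_apply_eq]
    · rw [Matrix.diagonal_apply_ne _ hji]
      exact hb i j (Or.inl ⟨by omega, by omega⟩) hji
  have hdet : (A : Matrix (Fin 3 × Fin 3) (Fin 3 × Fin 3) ℂ).det ≠ 0 :=
    (Matrix.isUnits_det_units A).ne_zero
  have hd0 : ∀ i, dA i ≠ 0 := by
    intro i h0
    apply hdet
    rw [hMdiag, Matrix.det_diagonal]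
    exact Finset.prod_eq_zero (Finset.mem_univ i) h0
  have hrel : ∀ i k j l : Fin 3, dA (i, j) * dA (k, l) = dA (i, l) * dA (k, j) :=
    fun i k j l => hc i k j l (by omega) (by omega) (by omega) (by omega)
  set χ : ℂ := (∏ i : Fin 3, dA (i, 0) / dA (0, 0)) * ∏ j : Fin 3, dA (0, j) with hχ
  refine kLimit_linSubst_stable_of_semiInvariant isBorderApolarLimit_diag _
    (Matrix.isUnits_det_units A) (fun _ => χ) fun t => ?_
  rw [Pdiag_eq t, hMdiag, ← AlgHom.comp_apply, ← linSubst_mul, Matrix.diagonal_mul_diagonal]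
  have hcomm : (Matrix.diagonal fun i : Fin 3 × Fin 3 => dA i * ((t : ℂ) + 2) ^ wDiag i) =
      (Matrix.diagonal fun i : Fin 3 × Fin 3 => ((t : ℂ) + 2) ^ wDiag i) * Matrix.diagonal dA := by
    rw [Matrix.diagonal_mul_diagonal]
    congr 1
    funext i
    ring
  rw [hcomm, linSubst_mul, AlgHom.comp_apply, linSubst_diagonal_detPoly dA hrel (hd0 _), map_smul]

/-- (GEN) `∂^e ∈ Jdiag 3` for every degree-3 exponent `e ≠ e_id`. -/
theorem monomial_mem_Jdiag_three (e : (Fin 3 × Fin 3) →₀ ℕ) (he : e.degree = 3) (hne : e ≠ eId) :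
    (monomial e (1 : ℂ)) ∈ Jdiag 3 :=
  mem_Jdiag_iff.2 (monomial_mem_inSpan_three e he hne)

/-- (BDRY) **`Jdiag` is not an interior point**: for no `g ∈ GL_9` is `Jdiag` the border-apolar limit of
the constant sequence `g · det_3`.  Otherwise `Ann_3(g·det_3) ⊇ {∂^e : e ≠ e_id}` (closedness of a
finite-dimensional annihilator), so `g·det_3 ∝ x₀₀x₁₁x₂₂`, whose degree-1 annihilator contains `∂₀₁`,
contradicting `dim Ann_1(g·det_3) = 9 - 9 = 0` (`stub_annSubmodule`). [folklore] -/
theorem Jdiag_not_interior (g : Matrix.GeneralLinearGroup (Fin 3 × Fin 3) ℂ) :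
    ¬ IsBorderApolarLimit 3
      (fun _ : ℕ => linSubst (Fin 3 × Fin 3) ℂ (g : Matrix (Fin 3 × Fin 3) (Fin 3 × Fin 3) ℂ) (detPoly (Fin 3) ℂ))
      Jdiag := by
  classical
  intro hI
  set F : MvPolynomial (Fin 3 × Fin 3) ℂ :=
    linSubst (Fin 3 × Fin 3) ℂ (g : Matrix (Fin 3 × Fin 3) (Fin 3 × Fin 3) ℂ) (detPoly (Fin 3) ℂ) with hF
  have hForb : F ∈ glOrbit (Fin 3 × Fin 3) ℂ (detPoly (Fin 3) ℂ) := ⟨g, rfl⟩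
  have hFhom : F.IsHomogeneous 3 := linSubst_isHomogeneous _ detPoly_three_isHomogeneous
  haveI hfin : ∀ k, Module.Finite ℂ (homogeneousSubmodule (Fin 3 × Fin 3) ℂ k) := fun k =>
    Module.Finite.iff_fg.2 (homogeneousSubmodule_fg _ _ k)
  -- every `∂^e`, `e ≠ e_id` of degree 3, annihilates `F`
  have hcoeff : ∀ e : (Fin 3 × Fin 3) →₀ ℕ, e.degree = 3 → e ≠ eId → coeff e F = 0 := by
    intro e he hne
    obtain ⟨Ds, hDs, hDlim⟩ := hI.1 3 le_rfl _ (monomial_mem_Jdiag_three e he hne)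
    obtain ⟨A3, hA3, hA3le, -⟩ := exists_annSubmodule 3 F
    haveI : FiniteDimensional ℂ A3 := Submodule.finiteDimensional_of_le hA3le
    have hmemA : monomial e (1 : ℂ) ∈ A3 :=
      ca_mem_of_tendsto_coeffVec A3 (fun t => by
        rw [← SetLike.mem_coe, hA3, mem_annihilatorOfDegree_iff]; exact hDs t) hDlim
    rw [← SetLike.mem_coe, hA3, mem_annihilatorOfDegree_iff] at hmemA
    have h2 := hmemA.2
    rw [apolarAction_eq_C (isHomogeneous_monomial (1 : ℂ) he) hFhom, support_monomial,
      if_neg one_ne_zero, Finset.sum_singleton, coeff_monomial, if_pos rfl, one_mul, ← C_0] at h2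
    have h3 := mul_eq_zero.1 (C_injective _ _ h2)
    exact h3.resolve_right (prod_factorial_ne_zero e)
  -- hence `F = F_{e_id} · x₀₀x₁₁x₂₂`
  have hFeq : F = monomial eId (coeff eId F) := by
    ext d
    rw [coeff_monomial]
    by_cases hd : eId = d
    · rw [if_pos hd, hd]
    · rw [if_neg hd]
      by_cases hdeg : d.degree = 3
      · exact hcoeff d hdeg (Ne.symm hd)
      · exact hFhom.coeff_eq_zero hdeg
  -- so `∂₀₁ ∈ Ann_1(F)`, while `dim Ann_1(F) = 0`
  have hX : (X (0, 1) : MvPolynomial (Fin 3 × Fin 3) ℂ) ∈ annihilatorOfDegree F 1 := by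
    rw [mem_annihilatorOfDegree_iff]
    refine ⟨isHomogeneous_X ℂ (0, 1), ?_⟩
    rw [apolarAction_X, hFeq, pderiv_monomial]
    have h0 : eId ((0 : Fin 3), (1 : Fin 3)) = 0 := by
      rw [eId, permMonomial_apply]; decide
    rw [h0, Nat.cast_zero, mul_zero, monomial_zero]
  obtain ⟨A1, hA1, hA1le, hA1dim⟩ := stub_annSubmodule 3 1 F hForb
  haveI : FiniteDimensional ℂ A1 := Submodule.finiteDimensional_of_le hA1le
  have hdim0 : Module.finrank ℂ A1 = 0 := by rw [hA1dim]; decide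
  have hbot : A1 = ⊥ := Submodule.finrank_eq_zero.1 hdim0
  have hXA : (X (0, 1) : MvPolynomial (Fin 3 × Fin 3) ℂ) ∈ A1 := by
    rw [← SetLike.mem_coe, hA1]; exact hX
  rw [hbot, Submodule.mem_bot] at hXA
  exact X_ne_zero _ hXA

/-- **`¬ ToricFixedPointsInterior`.**  The `H₀(3,3)`-fixed Kuratowski limit `Jdiag` of the toric curve
`diag((t+2)^{wDiag}) · det_3` (limit form `x₀₀x₁₁x₂₂`) satisfies every hypothesis of the crux
(`Pdiag_mem_glOrbit`, `isBorderApolarLimit_diag`, `Jdiag_h0Stable`) but is not an interior point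
(`Jdiag_not_interior`): BOUNDARY fixed points of `Z_det` exist, so the translate-and-degenerate shape
(`w ≠ 0`) of the crux's conclusion is essential. [folklore] -/
theorem toricFixedPointsInterior_false : ¬ ToricFixedPointsInterior := by
  intro h
  have h33 := @h 3 3 inferInstance le_rfl le_rfl
  dsimp only at h33
  obtain ⟨g, hLi', hLs'⟩ := h33 Pdiag Jdiag Pdiag_mem_glOrbit isBorderApolarLimit_diag Jdiag_h0Stable
  exact Jdiag_not_interior g ⟨hLi', hLs'⟩

end Summit.ValiantsHypothesis.Cruxes.ToricFixedPoints.Negative
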